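import Literature.NumberTheory.Automorphic.RankinSelbergTorusIntegralComplex
import Literature.NumberTheory.Automorphic.TorusWeightModulus
import Literature.Analysis.Complex.HolomorphicParametricIntegral
import HarnessLib

/-!
# The unfolded Rankin–Selberg integral is holomorphic in `s` (dominated holomorphic parametric integrals
against the torus weight `|det a|^s δ_B(a)⁻¹`)

Topic `NumberTheory/Automorphic`; namespace `Literature.NumberTheory.Automorphic`. Proof file (theorems
only: no definition, no named fact, no instance). The unfolded global Rankin–Selberg integral at a complex
point, `Ψ(s; W, W̄, Φ) = rankinSelbergTorusIntegralC νA νK W Φ s = ∫ |W|² Φ(e_n ·) |det a|^s δ_B(a)⁻¹`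
(`RankinSelbergTorusIntegralComplex`), its box integrals `∫_{B × K} I_s` (the "`S'`-parts" of the Euler
factorisation, `RankinSelbergTorusEulerLimit`) and their analogues for a pair `W W'` are integrals of
`F(p) · |det a|^s δ_B(a)⁻¹` with `F` independent of `s`. In print these are holomorphic wherever they
converge absolutely ("the integrals converge absolutely for `Re s > 1` … uniformly on compacta", Jacquet–Shalika
(1981), §4, (4.6); Cogdell (2004), §2.3, proof of Thm. 2.1–2.2), which is what the identity theorem needs
to upgrade the real-point identities of the tree (`WhittakerTowerParseval`, `RankinSelbergTorusEulerExact`)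
to identities of holomorphic functions on `Re s > 1`. This file proves it:

* `torusWeight_eq_prod_rpow_mul`, `torusWeight_le_add` — `|det a|^σ δ_B(a)⁻¹ = (∏ ‖a_i‖)^σ · D(a)` with
  `D(a) > 0` (`prod_rpow_sub_eq` of `TorusWeightModulus`), hence the two-sided domination
  `w_σ(a) ≤ w_{σ₁}(a) + w_{σ₂}(a)` for `σ₁ ≤ σ ≤ σ₂` (`T^σ ≤ T^{σ₁} + T^{σ₂}`);
* `differentiable_torusWeightC` — `s ↦ |det a|^s δ_B(a)⁻¹` is entire;
* `differentiableOn_integral_mul_torusWeightC` (**main, generic**) — for `F : Y → ℂ` and a torus coordinate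
  `a : Y → (𝔸_Kˣ)ⁿ` with `s ↦ F(y) w_s(a y)` a.e. strongly measurable and `∫ ‖F‖ w_σ(a ·) dm < ∞` for all
  `σ ∈ (σ₁, σ₂)`, the function `s ↦ ∫ F(y) w_s(a y) dm` is holomorphic on the strip `σ₁ < Re s < σ₂`
  (`Literature.Analysis.Complex.differentiableOn_integral_of_dominated`, dominated near `s₀` by
  `‖F‖ (w_{σ₀-R} + w_{σ₀+R})`);
* `differentiableOn_setIntegral_torusIntegrandC`, `differentiableOn_rankinSelbergTorusIntegralC` — **the
  unfolded integral `Ψ(s; W, W̄, Φ)` and all its box integrals are holomorphic on every strip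
  `σ₁ < Re s < σ₂` on which the real torus integrals `Ψ(σ; W, W̄, Φ)` are finite** (`Φ ≥ 0`);
* `differentiableOn_setIntegral_mul_mul_torusWeightC` — the same for the pair integrand
  `W W' Φ(e_n ·) w_s` from the finiteness of the real integrals of `W` and of `W'`
  (`|W W'| ≤ ½ (|W|² + |W'|²)`).

## References

* H. Jacquet, J. A. Shalika, *On Euler products and the classification of automorphic
  representations I*, Amer. J. Math. 103 (1981), §4 [JacquetShalikaAJM1981].
* J. W. Cogdell, *Analytic theory of L-functions for GL_n*, in *An Introduction to the Langlands
  Program* (2004), §2.3 [CogdellAnalyticTheory2004].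
-/

noncomputable section

open MeasureTheory Measure NumberField IsDedekindDomain Matrix Set Filter Finset Topology Metric
open scoped MatrixGroups ENNReal NNReal ComplexConjugate
open Literature.NumberTheory.GaloisRepresentations (ideleGroup)

namespace Literature.NumberTheory.Automorphic

/-! ### The torus weight: factorisation and two-sided domination -/

section Weight

variable {n : ℕ} {K : Type} [Field K] [NumberField K]

/-- **`|det a|^σ δ_B(a)⁻¹ = (∏_j ‖a_j‖)^σ · D(a)`** with `D(a) = (∏_c ∏_{i<c} ‖a_i‖/‖a_c‖)⁻¹ > 0`
independent of `σ` (`prod_rpow_sub_eq`). [folklore] -/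
theorem torusWeight_eq_prod_rpow_mul (σ : ℝ) (a : Fin n → ideleGroup K) :
    torusWeight n K σ a =
      (∏ j : Fin n, ((IdeleClassGroup.ideleNorm K (a j) : ℝ≥0) : ℝ)) ^ σ *
        (∏ c : Fin n, ∏ i ∈ univ.filter (fun i : Fin n => i < c),
          (((IdeleClassGroup.ideleNorm K (a i) : ℝ≥0) : ℝ) / ((IdeleClassGroup.ideleNorm K (a c) : ℝ≥0) : ℝ)))⁻¹ := by
  unfold torusWeight
  exact prod_rpow_sub_eq (fun j => ((IdeleClassGroup.ideleNorm K (a j) : ℝ≥0) : ℝ)) (fun j => ideleNorm_coe_pos K (a j)) σ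

/-- **Two-sided domination of the torus weight**: `w_σ(a) ≤ w_{σ₁}(a) + w_{σ₂}(a)` for `σ₁ ≤ σ ≤ σ₂`
(`w_σ = T^σ D` with `T, D > 0`). [folklore] -/
theorem torusWeight_le_add {σ₁ σ σ₂ : ℝ} (h₁ : σ₁ ≤ σ) (h₂ : σ ≤ σ₂) (a : Fin n → ideleGroup K) :
    torusWeight n K σ a ≤ torusWeight n K σ₁ a + torusWeight n K σ₂ a := by
  rw [torusWeight_eq_prod_rpow_mul, torusWeight_eq_prod_rpow_mul, torusWeight_eq_prod_rpow_mul, ← add_mul]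
  have hT : 0 < ∏ j : Fin n, ((IdeleClassGroup.ideleNorm K (a j) : ℝ≥0) : ℝ) :=
    prod_pos fun j _ => ideleNorm_coe_pos K (a j)
  have hD : 0 ≤ (∏ c : Fin n, ∏ i ∈ univ.filter (fun i : Fin n => i < c),
      (((IdeleClassGroup.ideleNorm K (a i) : ℝ≥0) : ℝ) / ((IdeleClassGroup.ideleNorm K (a c) : ℝ≥0) : ℝ)))⁻¹ :=
    inv_nonneg.2 (prod_nonneg fun c _ => prod_nonneg fun i _ =>
      div_nonneg (NNReal.coe_nonneg _) (NNReal.coe_nonneg _))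
  -- two-sided domination of real powers: `T^σ ≤ T^{σ₁} + T^{σ₂}` (`T ≤ 1` / `T ≥ 1`), as
  -- `rpow_le_rpow_add_rpow_of_le_of_le` of `PairLFunctionPolesRealMoments` (not imported here)
  have hpow : (∏ j : Fin n, ((IdeleClassGroup.ideleNorm K (a j) : ℝ≥0) : ℝ)) ^ σ ≤
      (∏ j : Fin n, ((IdeleClassGroup.ideleNorm K (a j) : ℝ≥0) : ℝ)) ^ σ₁ +
        (∏ j : Fin n, ((IdeleClassGroup.ideleNorm K (a j) : ℝ≥0) : ℝ)) ^ σ₂ := by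
    rcases le_or_gt (∏ j : Fin n, ((IdeleClassGroup.ideleNorm K (a j) : ℝ≥0) : ℝ)) 1 with h1 | h1
    · exact (Real.rpow_le_rpow_of_exponent_ge hT h1 h₁).trans (le_add_of_nonneg_right (Real.rpow_nonneg hT.le _))
    · exact (Real.rpow_le_rpow_of_exponent_le h1.le h₂).trans (le_add_of_nonneg_left (Real.rpow_nonneg hT.le _))
  exact mul_le_mul_of_nonneg_right hpow hD

/-- **`s ↦ |det a|^s δ_B(a)⁻¹` is entire** (a finite product of `s ↦ c^{s - d}`, `c > 0`). [folklore] -/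
theorem differentiable_torusWeightC (a : Fin n → ideleGroup K) : Differentiable ℂ fun s : ℂ => torusWeightC n K s a := by
  unfold torusWeightC
  refine Differentiable.fun_finsetProd fun i _ => ?_
  exact (differentiable_id.sub_const _).const_cpow
    (Or.inl (Complex.ofReal_ne_zero.2 (ideleNorm_coe_pos K (a i)).ne'))

end Weight

/-! ### Holomorphic parametric integrals against the torus weight -/

section Generic

variable {n : ℕ} {K : Type} [Field K] [NumberField K]
variable {Y : Type*} [MeasurableSpace Y] {m : Measure Y}

/-- `re s` stays within `R` of `re s₀` on the ball of radius `R`. [folklore] -/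
theorem abs_re_sub_re_lt_of_mem_ball {s s₀ : ℂ} {R : ℝ} (hs : s ∈ ball s₀ R) :
    s₀.re - R < s.re ∧ s.re < s₀.re + R := by
  rw [Metric.mem_ball, dist_eq_norm] at hs
  have h1 : |s.re - s₀.re| ≤ ‖s - s₀‖ := by simpa [Complex.sub_re] using Complex.abs_re_le_norm (s - s₀)
  have h2 := abs_lt.mp (lt_of_le_of_lt h1 hs)
  constructor <;> linarith [h2.1, h2.2]

/-- **Holomorphic parametric integrals against the torus weight** (generic form). Let `F : Y → ℂ` and
`a : Y → (𝔸_Kˣ)ⁿ` be such that `y ↦ F(y) w_s(a y)` is a.e. strongly measurable for every `s` and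
`∫ ‖F(y)‖ w_σ(a y) dm < ∞` for every real `σ ∈ (σ₁, σ₂)`. Then `s ↦ ∫ F(y) w_s(a y) dm` is holomorphic on
the strip `σ₁ < Re s < σ₂`: the integrand is entire in `s` and dominated on the ball of radius
`R = ½ min(Re s₀ - σ₁, σ₂ - Re s₀)` around `s₀` by `‖F‖ (w_{Re s₀ - R} + w_{Re s₀ + R})`
(`torusWeight_le_add`; `Literature.Analysis.Complex.differentiableOn_integral_of_dominated`).
[cite: CogdellAnalyticTheory2004, §2.3 (proof of Thm. 2.1)] -/
theorem differentiableOn_integral_mul_torusWeightC {F : Y → ℂ} {a : Y → (Fin n → ideleGroup K)} {σ₁ σ₂ : ℝ}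
    (hm : ∀ s : ℂ, AEStronglyMeasurable (fun y => F y * torusWeightC n K s (a y)) m)
    (hint : ∀ σ : ℝ, σ₁ < σ → σ < σ₂ → Integrable (fun y => ‖F y‖ * torusWeight n K σ (a y)) m) :
    DifferentiableOn ℂ (fun s : ℂ => ∫ y, F y * torusWeightC n K s (a y) ∂m) {s : ℂ | σ₁ < s.re ∧ s.re < σ₂} := by
  refine Literature.Analysis.Complex.differentiableOn_integral_of_dominated (fun s _ => hm s)
    (Eventually.of_forall fun y s _ => (((differentiable_torusWeightC (a y)).const_mul (F y)) s).differentiableWithinAt) ?_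
  intro s₀ hs₀
  obtain ⟨h₁, h₂⟩ := hs₀
  set R : ℝ := min (s₀.re - σ₁) (σ₂ - s₀.re) / 2 with hR
  have hRpos : 0 < R := by
    rw [hR]
    have := lt_min (sub_pos.2 h₁) (sub_pos.2 h₂)
    linarith
  have hR1 : σ₁ < s₀.re - R := by
    have : R < s₀.re - σ₁ := by
      rw [hR]; linarith [min_le_left (s₀.re - σ₁) (σ₂ - s₀.re), sub_pos.2 h₁]
    linarith
  have hR2 : s₀.re + R < σ₂ := by
    have : R < σ₂ - s₀.re := by
      rw [hR]; linarith [min_le_right (s₀.re - σ₁) (σ₂ - s₀.re), sub_pos.2 h₂]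
    linarith
  refine ⟨R, hRpos, fun s hs => ?_, fun y => ‖F y‖ * torusWeight n K (s₀.re - R) (a y) +
      ‖F y‖ * torusWeight n K (s₀.re + R) (a y),
    (hint _ hR1 (by linarith)).add (hint _ (by linarith) hR2), Eventually.of_forall fun y s hs => ?_⟩
  · obtain ⟨hl, hu⟩ := abs_re_sub_re_lt_of_mem_ball hs
    exact ⟨lt_trans hR1 hl, lt_trans hu hR2⟩
  · obtain ⟨hl, hu⟩ := abs_re_sub_re_lt_of_mem_ball hs
    change ‖F y * torusWeightC n K s (a y)‖ ≤
      ‖F y‖ * torusWeight n K (s₀.re - R) (a y) + ‖F y‖ * torusWeight n K (s₀.re + R) (a y)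
    rw [norm_mul, norm_torusWeightC, ← mul_add]
    exact mul_le_mul_of_nonneg_left (torusWeight_le_add hl.le hu.le (a y)) (norm_nonneg _)

end Generic

/-! ### The unfolded Rankin–Selberg integral and its box integrals -/

section Torus

variable {n : ℕ} {K : Type} [Field K] [NumberField K]
variable [MeasurableSpace (ideleGroup K)] [MeasurableSpace (AdelicGroupData.gl n K).Adelic]
variable (νA : Measure (Fin n → ideleGroup K)) (νK : Measure ↥(maximalCompactAdelic n K))
variable {W W' : GL (Fin n) (AdeleRing (𝓞 K) K) → ℂ} {Φ : (Fin n → AdeleRing (𝓞 K) K) → ℝ}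

omit [MeasurableSpace (ideleGroup K)] [MeasurableSpace (AdelicGroupData.gl n K).Adelic] in
/-- The real integrand at `σ` as `‖F‖ w_σ` with `F = |W|² Φ` (`Φ ≥ 0`). [folklore] -/
theorem norm_mul_torusWeight_eq_toReal_torusIntegrand (hΦ : ∀ y, 0 ≤ Φ y) (σ : ℝ)
    (p : (Fin n → ideleGroup K) × ↥(maximalCompactAdelic n K)) :
    ‖(((‖W (torusPoint n K p)‖ ^ 2 * Φ (lastRow n K (torusPoint n K p)) : ℝ)) : ℂ)‖ * torusWeight n K σ p.1 =
      (torusIntegrand n K W Φ σ p).toReal := by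
  rw [Complex.norm_real, Real.norm_of_nonneg (mul_nonneg (sq_nonneg _) (hΦ _)), torusIntegrand,
    ENNReal.toReal_ofReal (mul_nonneg (mul_nonneg (sq_nonneg _) (hΦ _)) (torusWeight_nonneg σ p.1))]

/-- **The box integrals `∫_{B} I_s` of the unfolded Rankin–Selberg integral are holomorphic** on every
strip `σ₁ < Re s < σ₂` on which the real torus integrals `Ψ(σ; W, W̄, Φ)` are finite (`Φ ≥ 0`, `I_s`
a.e. strongly measurable, the real integrands measurable); `B` any measurable set of the torus × compact
coordinates (e.g. `B(F) × K`). [cite: CogdellAnalyticTheory2004, §2.3 (proof of Thm. 2.1)] -/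
theorem differentiableOn_setIntegral_torusIntegrandC (hΦ : ∀ y, 0 ≤ Φ y) {σ₁ σ₂ : ℝ}
    (hm : ∀ s : ℂ, AEStronglyMeasurable (torusIntegrandC n K W Φ s) (νA.prod νK))
    (hmr : ∀ σ : ℝ, Measurable (torusIntegrand n K W Φ σ))
    (hfin : ∀ σ : ℝ, σ₁ < σ → σ < σ₂ → rankinSelbergTorusIntegral n K νA νK W Φ σ ≠ ⊤)
    (B : Set ((Fin n → ideleGroup K) × ↥(maximalCompactAdelic n K))) :
    DifferentiableOn ℂ (fun s : ℂ => ∫ p in B, torusIntegrandC n K W Φ s p ∂(νA.prod νK))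
      {s : ℂ | σ₁ < s.re ∧ s.re < σ₂} := by
  have h := differentiableOn_integral_mul_torusWeightC (n := n) (K := K) (m := (νA.prod νK).restrict B)
    (F := fun p : (Fin n → ideleGroup K) × ↥(maximalCompactAdelic n K) =>
      (((‖W (torusPoint n K p)‖ ^ 2 * Φ (lastRow n K (torusPoint n K p)) : ℝ)) : ℂ))
    (a := Prod.fst) (σ₁ := σ₁) (σ₂ := σ₂) (fun s => (hm s).restrict) (fun σ hσ₁ hσ₂ => by
      simp_rw [norm_mul_torusWeight_eq_toReal_torusIntegrand hΦ σ]
      exact (integrable_toReal_of_lintegral_ne_top (hmr σ).aemeasurable (hfin σ hσ₁ hσ₂)).restrict)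
  exact h

/-- **The unfolded Rankin–Selberg integral `Ψ(s; W, W̄, Φ) = rankinSelbergTorusIntegralC νA νK W Φ s` is
holomorphic** on every strip `σ₁ < Re s < σ₂` on which the real torus integrals are finite ("the
integrals converge absolutely … uniformly on compacta", Jacquet–Shalika (1981), §4, (4.6); Cogdell (2004),
§2.3). [cite: CogdellAnalyticTheory2004, §2.3 (proof of Thm. 2.1)] -/
theorem differentiableOn_rankinSelbergTorusIntegralC (hΦ : ∀ y, 0 ≤ Φ y) {σ₁ σ₂ : ℝ}
    (hm : ∀ s : ℂ, AEStronglyMeasurable (torusIntegrandC n K W Φ s) (νA.prod νK))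
    (hmr : ∀ σ : ℝ, Measurable (torusIntegrand n K W Φ σ))
    (hfin : ∀ σ : ℝ, σ₁ < σ → σ < σ₂ → rankinSelbergTorusIntegral n K νA νK W Φ σ ≠ ⊤) :
    DifferentiableOn ℂ (rankinSelbergTorusIntegralC n K νA νK W Φ) {s : ℂ | σ₁ < s.re ∧ s.re < σ₂} := by
  have h := differentiableOn_setIntegral_torusIntegrandC νA νK hΦ hm hmr hfin Set.univ
  simp_rw [Measure.restrict_univ] at h
  exact h

omit [MeasurableSpace (ideleGroup K)] [MeasurableSpace (AdelicGroupData.gl n K).Adelic] in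
/-- `‖W W' Φ‖ w_σ ≤ ½ (I_σ(W) + I_σ(W'))` for the pair integrand (`Φ ≥ 0`). [folklore] -/
theorem norm_mul_mul_mul_torusWeight_le (hΦ : ∀ y, 0 ≤ Φ y) (σ : ℝ)
    (p : (Fin n → ideleGroup K) × ↥(maximalCompactAdelic n K)) :
    ‖W (torusPoint n K p) * W' (torusPoint n K p) * (Φ (lastRow n K (torusPoint n K p)) : ℂ)‖ * torusWeight n K σ p.1 ≤
      ((torusIntegrand n K W Φ σ p).toReal + (torusIntegrand n K W' Φ σ p).toReal) / 2 := by
  have hw : 0 ≤ Φ (lastRow n K (torusPoint n K p)) * torusWeight n K σ p.1 :=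
    mul_nonneg (hΦ _) (torusWeight_nonneg σ p.1)
  rw [norm_mul, norm_mul, Complex.norm_real, Real.norm_of_nonneg (hΦ _), torusIntegrand, torusIntegrand,
    ENNReal.toReal_ofReal (mul_nonneg (mul_nonneg (sq_nonneg _) (hΦ _)) (torusWeight_nonneg σ p.1)),
    ENNReal.toReal_ofReal (mul_nonneg (mul_nonneg (sq_nonneg _) (hΦ _)) (torusWeight_nonneg σ p.1))]
  nlinarith [two_mul_le_add_sq ‖W (torusPoint n K p)‖ ‖W' (torusPoint n K p)‖,
    mul_nonneg (mul_nonneg (norm_nonneg (W (torusPoint n K p))) (norm_nonneg (W' (torusPoint n K p)))) hw,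
    sq_nonneg ‖W (torusPoint n K p)‖, sq_nonneg ‖W' (torusPoint n K p)‖]

/-- **The pair integrals `∫_B W W' Φ(e_n ·) w_s` are holomorphic** on every strip `σ₁ < Re s < σ₂` on which
the real torus integrals of `W` and of `W'` are finite (domination by `½ (|W|² + |W'|²) Φ w_σ`): the
unfolded Rankin–Selberg integral of a pair and its `S'`-parts (Cogdell (2004), §2.3, Thm. 2.1 for
`(φ, φ')`). [cite: CogdellAnalyticTheory2004, §2.3 (proof of Thm. 2.1)] -/
theorem differentiableOn_setIntegral_mul_mul_torusWeightC (hΦ : ∀ y, 0 ≤ Φ y) {σ₁ σ₂ : ℝ}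
    (hm : ∀ s : ℂ, AEStronglyMeasurable (fun p : (Fin n → ideleGroup K) × ↥(maximalCompactAdelic n K) =>
      W (torusPoint n K p) * W' (torusPoint n K p) * (Φ (lastRow n K (torusPoint n K p)) : ℂ) *
        torusWeightC n K s p.1) (νA.prod νK))
    (hmr : ∀ σ : ℝ, Measurable (torusIntegrand n K W Φ σ)) (hmr' : ∀ σ : ℝ, Measurable (torusIntegrand n K W' Φ σ))
    (hfin : ∀ σ : ℝ, σ₁ < σ → σ < σ₂ → rankinSelbergTorusIntegral n K νA νK W Φ σ ≠ ⊤)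
    (hfin' : ∀ σ : ℝ, σ₁ < σ → σ < σ₂ → rankinSelbergTorusIntegral n K νA νK W' Φ σ ≠ ⊤)
    (B : Set ((Fin n → ideleGroup K) × ↥(maximalCompactAdelic n K))) :
    DifferentiableOn ℂ (fun s : ℂ => ∫ p in B, W (torusPoint n K p) * W' (torusPoint n K p) *
        (Φ (lastRow n K (torusPoint n K p)) : ℂ) * torusWeightC n K s p.1 ∂(νA.prod νK))
      {s : ℂ | σ₁ < s.re ∧ s.re < σ₂} := by
  refine differentiableOn_integral_mul_torusWeightC (n := n) (K := K) (m := (νA.prod νK).restrict B)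
    (F := fun p : (Fin n → ideleGroup K) × ↥(maximalCompactAdelic n K) =>
      W (torusPoint n K p) * W' (torusPoint n K p) * (Φ (lastRow n K (torusPoint n K p)) : ℂ))
    (a := Prod.fst) (fun s => (hm s).restrict) (fun σ hσ₁ hσ₂ => ?_)
  refine (Integrable.mono' ((((integrable_toReal_of_lintegral_ne_top (hmr σ).aemeasurable (hfin σ hσ₁ hσ₂)).add
    (integrable_toReal_of_lintegral_ne_top (hmr' σ).aemeasurable (hfin' σ hσ₁ hσ₂))).div_const 2).restrict) ?_
    (Eventually.of_forall fun p => ?_))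
  · have h := (hm (σ : ℂ)).restrict (s := B)
    have heq : (fun p : (Fin n → ideleGroup K) × ↥(maximalCompactAdelic n K) =>
        ‖W (torusPoint n K p) * W' (torusPoint n K p) * (Φ (lastRow n K (torusPoint n K p)) : ℂ)‖ * torusWeight n K σ p.1) =
        fun p => ‖W (torusPoint n K p) * W' (torusPoint n K p) * (Φ (lastRow n K (torusPoint n K p)) : ℂ) *
          torusWeightC n K (σ : ℂ) p.1‖ := by
      funext p
      rw [norm_mul _ (torusWeightC n K (σ : ℂ) p.1), norm_torusWeightC, Complex.ofReal_re]
    rw [heq]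
    exact h.norm
  · rw [Real.norm_of_nonneg (mul_nonneg (norm_nonneg _) (torusWeight_nonneg σ p.1))]
    exact norm_mul_mul_mul_torusWeight_le hΦ σ p

end Torus

end Literature.NumberTheory.Automorphic
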